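/-
# (Iw-S₀) FILE B ED. 2 — THE MONOMIAL-FLAT LOCAL FACE WITH ITS PIECES EXPORTED AND ITS GROWTH REDUCED TO THE PIECES

ED. 1 (★ p865083 `K2LiuKindOneSingularLocalFaceMonomial.exists_localFace_kindOneSingular_monomial`) hides the cut behind `∃ Gn`.  The `hGnv` payer of the
K1-a♮ line (★ p864748 `K2LiuKindOneSingularLocalFaceGrowth.hGnv_of_localFace`, consumer LH7-p05's `hGnb_of_placeBounds`) needs GROWTH of `Gn` near every `z`,
uniformly in `h`, and growth is paid PER PIECE from ball ∕ value data (★ p863695 `K2LiuKindOneSingularLocalFaceBall` and its editions).  THIS EDITION exports,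
next to ED. 1's two clauses VERBATIM: the finite label set `S = Hf(K₀)` ((L): `c > 0`, `c² ∈ q_v^ℤ`), the pieces `F_c` BY VALUE ((P): the cut formula) with their
certificates ((P1) Siegel, (P2) smooth, (P3) `K₀`-flat — so ANY local-face edition applies to `F_c`), the per-piece letters `Gn₀ c` of ★ p863501 ((G1) regular on
`0 < re`, (G2) the twisted big-cell integral of `F_c` on `1 < re s` — by the identity principle ★ `IsQRationalRegularAt.eq_of_eqOn_halfPlane` any other edition's
witness for `F_c` agrees with `Gn₀ c` on `0 < re s`), the assembly (A) `Gn = Σ_{c ∈ S} c^(2(s−s₀))·Gn₀ c`, and the GROWTH REDUCTION (N) `‖Gn s h‖ ≤ Σ_c c^(2re(s−s₀))·‖Gn₀ c s h‖`,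
(N′) `‖Gn s h‖ ≤ q_v^M · Σ_c ‖Gn₀ c s h‖` on the unit disc at any `z` (`M` from (L), uniform in `h`).

§1 generic bookkeeping (norm of a finite sum of monomials; `c^(2x) ≤ q^M` on a disc when `c² = q^K`); §2 the pieces with their defining equation (ED. 2 of
★ `exists_monomialFlat_pieces`, same proof, the equation exported); §3 the head `exists_localFace_kindOneSingular_monomial_growth`.

References: [cite: KudlaRallis1994, §2] [cite: KudlaSweet1997, §1] [cite: HarrisKudlaSweet1996, §6 (6.14)–(6.16)] [cite: Casselman1980, §3 Thm. 3.1] [cite: Shimura1997, §18.1 (18.4)].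
-/
import Summits.HodgeConjecture.HodgeConjecture.Theorems.K2LiuKindOneSingularLocalFaceMonomial   -- ★ p865083 ED. 1 (§1 cut lemmas, §2 finiteness ∕ `cpow` ∕ assembly, §3 V1c twin) + ★ p863501
import HarnessLib

set_option autoImplicit false
set_option linter.dupNamespace false -- the mandated namespace repeats `HodgeConjecture.HodgeConjecture`

noncomputable section

open scoped Classical NNReal ENNReal ComplexConjugate
open NumberField IsDedekindDomain Matrix MeasureTheory Topology
open Literature.NumberTheory.GaloisRepresentations.IsNonarchimedeanLocalField
open Literature.NumberTheory.Automorphic Literature.NumberTheory.Automorphic.UnitaryGroup Literature.NumberTheory.GaloisRepresentations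
open Literature.NumberTheory.GelbartRogawski1991 Literature.NumberTheory.GelbartRogawski1991.GRConstruction
open Literature.NumberTheory.GelbartRogawski1991.UnitaryDualPair Literature.NumberTheory.GelbartRogawski1991.UnitaryDualPair.LocalSplitting
open Literature.NumberTheory.K2Lit Literature.NumberTheory.K2Lit.SiegelDoubled Literature.NumberTheory.K2Lit.LocalSiegelDoubled
open Summit.HodgeConjecture.HodgeConjecture.Cruxes.HLiu418.K2LiuQRationalDefs
open Summit.HodgeConjecture.HodgeConjecture.Cruxes.HLiu418.K2LiuFlatSiegelFamilies (isQRationalRegularAt_zpow_cpow_add)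
open Summit.HodgeConjecture.HodgeConjecture.Cruxes.HLiu418.K2LiuSiegelUnipotentLocalDefs (unipDeltaLoc)
open Summit.HodgeConjecture.HodgeConjecture.Cruxes.HLiu418.K2LiuSiegelUnipotentFourierDefs
open Summit.HodgeConjecture.HodgeConjecture.Cruxes.HLiu418.K2LiuSiegelUnipotentCharacters
open Summit.HodgeConjecture.HodgeConjecture.Cruxes.HLiu418.K2LiuKindOneSingularLocalFace (exists_localFace_kindOneSingular)
open Summit.HodgeConjecture.HodgeConjecture.Cruxes.HLiu418.K2LiuKindOneSingularLocalFaceMonomial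

namespace Summit.HodgeConjecture.HodgeConjecture.Cruxes.HLiu418.K2LiuKindOneSingularLocalFaceMonomialGrowth

/-! ## §1 Generic bookkeeping -/

section Generic

/-- `‖Σ_{c ∈ S} a_c·b_c‖ ≤ Σ_{c ∈ S} ‖a_c‖·‖b_c‖`. [folklore] -/
theorem norm_sum_mul_le (S : Finset ℝ) (a b : ℝ → ℂ) : ‖∑ c ∈ S, a c * b c‖ ≤ ∑ c ∈ S, ‖a c‖ * ‖b c‖ :=
  (norm_sum_le _ _).trans (Finset.sum_le_sum fun _ _ => norm_mul_le _ _)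

/-- `‖c^(2w)‖ = c^(2·re w)` for a positive real base. [folklore] -/
theorem norm_cpow_two_mul {c : ℝ} (hc : 0 < c) (w : ℂ) : ‖((c : ℝ) : ℂ) ^ (2 * w)‖ = c ^ (2 * w.re) := by
  rw [Complex.norm_cpow_eq_rpow_re_of_pos hc]
  congr 1
  simp [Complex.mul_re]

/-- on a disc: if `c > 0`, `c² = q^K`, `1 ≤ q`, `|x| ≤ R` and `|K|·R ≤ M`, then `c^(2x) ≤ q^M`. [folklore] -/
theorem rpow_two_mul_le_pow {q c : ℝ} (hq : 1 ≤ q) (hc : 0 < c) {K : ℤ} (hK : c ^ 2 = q ^ K) {x R : ℝ} (hx : |x| ≤ R) {M : ℕ}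
    (hM : |(K : ℝ)| * R ≤ M) : c ^ (2 * x) ≤ q ^ M := by
  have hq0 : 0 ≤ q := zero_le_one.trans hq
  have h1 : c ^ (2 * x) = q ^ ((K : ℝ) * x) := by
    rw [Real.rpow_mul hc.le, show (2 : ℝ) = ((2 : ℕ) : ℝ) by norm_num, Real.rpow_natCast, hK, ← Real.rpow_intCast, ← Real.rpow_mul hq0]
  rw [h1, ← Real.rpow_natCast]
  refine Real.rpow_le_rpow_of_exponent_le hq ?_
  calc (K : ℝ) * x ≤ |(K : ℝ) * x| := le_abs_self _
    _ = |(K : ℝ)| * |x| := abs_mul _ _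
    _ ≤ |(K : ℝ)| * R := mul_le_mul_of_nonneg_left hx (abs_nonneg _)
    _ ≤ M := hM

/-- **uniform exponent on a disc**: for a finite set of labels `c > 0` with `c² ∈ q^ℤ` (`1 ≤ q`) and any centre `z`, one `M : ℕ` with `c^(2·re(s − s₀)) ≤ q^M` for all
labels and all `s` with `dist s z < 1`. [folklore] -/
theorem exists_uniform_pow_bound {q : ℝ} (hq : 1 ≤ q) (S : Finset ℝ) (hS : ∀ c ∈ S, 0 < c ∧ ∃ K : ℤ, c ^ 2 = q ^ K) (z s₀ : ℂ) :
    ∃ M : ℕ, ∀ s : ℂ, dist s z < 1 → ∀ c ∈ S, c ^ (2 * (s - s₀).re) ≤ q ^ M := by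
  choose! K hK using fun c (hc : c ∈ S) => (hS c hc).2
  refine ⟨⌈(∑ c ∈ S, |(K c : ℝ)|) * (|z.re - s₀.re| + 1)⌉₊, fun s hs c hc => ?_⟩
  have hR : |(s - s₀).re| ≤ |z.re - s₀.re| + 1 := by
    have h1 : |s.re - z.re| ≤ dist s z := by rw [Complex.dist_eq, ← Complex.sub_re]; exact Complex.abs_re_le_norm _
    rw [Complex.sub_re]
    calc |s.re - s₀.re| = |(s.re - z.re) + (z.re - s₀.re)| := by ring_nf
      _ ≤ |s.re - z.re| + |z.re - s₀.re| := abs_add_le _ _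
      _ ≤ |z.re - s₀.re| + 1 := by linarith
  refine rpow_two_mul_le_pow hq (hS c hc).1 (hK c hc) hR ?_
  calc |(K c : ℝ)| * (|z.re - s₀.re| + 1) ≤ (∑ c' ∈ S, |(K c' : ℝ)|) * (|z.re - s₀.re| + 1) :=
        mul_le_mul_of_nonneg_right (Finset.single_le_sum (fun c' _ => abs_nonneg (K c' : ℝ)) hc) (by positivity)
    _ ≤ _ := Nat.le_ceil _

end Generic

/-! ## §2 The pieces with their defining equation (ED. 2 of ★ `exists_monomialFlat_pieces`) -/

section CM

variable (L : Type) [Field L] [NumberField L] [IsCMField L] {N M : ℕ} (e : Fin N × Fin M ≃ Fin 2)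
  (dV : Fin N → L) (hdV : ∀ i, IsCMField.complexConj L (dV i) = dV i) (hdV0 : ∀ i, dV i ≠ 0)
  (dW : Fin M → L) (hdW : ∀ i, IsCMField.complexConj L (dW i) = dW i) (hdW0 : ∀ i, dW i ≠ 0)
  (v : HeightOneSpectrum (𝓞 (Fp L)))

set_option maxHeartbeats 1600000 in -- MEASURED class of ★ `exists_monomialFlat_pieces` (same proof; ≈ 16 000 heartbeats per ★-binder ∕ Literature-binder contact, see ★ p865083's comment)
/-- **THE PIECES, WITH THEIR DEFINING EQUATION** — ED. 2 of ★ `K2LiuKindOneSingularLocalFaceMonomial.exists_monomialFlat_pieces` (same proof), exporting in addition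
(P) `F_c s u = c^(−2(s−s₀)) · 𝟙[∃ p k, p ∈ P_Δ(L⁺_v), k ∈ K₀, u = p·k, Hf k = c] · G s u` BY VALUE, so that value editions of the local face can be read on the pieces.
[cite: Casselman1980, §3 Thm. 3.1] [cite: HarrisKudlaSweet1996, §1 (1.15)] -/
theorem exists_monomialFlat_pieces_eq
    (χv : ∀ w : PlacesOver L v, (w.1.adicCompletion L)ˣ →* ℂˣ)
    (K₀ : Subgroup (UnitaryGroup.localPi L (IsCMField.complexConj L) (2 + 2) (hermD L e dV hdV dW hdW) v))
    (hK₀ : IsCompact (K₀ : Set (UnitaryGroup.localPi L (IsCMField.complexConj L) (2 + 2) (hermD L e dV hdV dW hdW) v)) ∧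
      IsOpen (K₀ : Set (UnitaryGroup.localPi L (IsCMField.complexConj L) (2 + 2) (hermD L e dV hdV dW hdW) v)))
    (hIw : haveI : Algebra.IsQuadraticExtension (Fp L) L := IsCMField.isQuadraticExtension L
      ∀ g : UnitaryGroup.localPi L (IsCMField.complexConj L) (2 + 2) (hermD L e dV hdV dW hdW) v,
        ∃ p, IsSiegelDelta (Fp L) L (IsCMField.complexConj L) (complexConj_imagUnit L) (imagUnit_ne_zero L) (imagUnit_mul_self L)
          v 2 (gramR_isSymm L e dV hdV dW hdW) (hermD_eq_map_gramD L e dV hdV dW hdW) p ∧ ∃ k ∈ K₀, g = p * k)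
    (G : ℂ → UnitaryGroup.localPi L (IsCMField.complexConj L) (2 + 2) (hermD L e dV hdV dW hdW) v → ℂ)
    (hSieg : haveI : Algebra.IsQuadraticExtension (Fp L) L := IsCMField.isQuadraticExtension L
      ∀ s, IsLocalSiegelSection (Fp L) L (IsCMField.complexConj L) (complexConj_imagUnit L) (imagUnit_ne_zero L) (imagUnit_mul_self L)
        v 2 (gramR_isSymm L e dV hdV dW hdW) (hermD_eq_map_gramD L e dV hdV dW hdW) χv s (G s))
    (hsm : ∀ s, IsSmooth (Fp L) L (IsCMField.complexConj L) v 2 (G s))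
    -- ★ p863501's `hflat` REPLACED by the MONOMIAL-FLAT letters (f1) (f2ᴷ) (f3) (f4) + `hG` of the (Iw-S₀) road (K1a desk WORD #3 ∕ #6 ∕ #8)
    (Hf : UnitaryGroup.localPi L (IsCMField.complexConj L) (2 + 2) (hermD L e dV hdV dW hdW) v → ℝ) (hf1 : ∀ u, 0 < Hf u)
    (hf2 : haveI : Algebra.IsQuadraticExtension (Fp L) L := IsCMField.isQuadraticExtension L
      ∀ p : UnitaryGroup.localPi L (IsCMField.complexConj L) (2 + 2) (hermD L e dV hdV dW hdW) v,
        IsSiegelDelta (Fp L) L (IsCMField.complexConj L) (complexConj_imagUnit L) (imagUnit_ne_zero L) (imagUnit_mul_self L)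
          v 2 (gramR_isSymm L e dV hdV dW hdW) (hermD_eq_map_gramD L e dV hdV dW hdW) p → p ∈ K₀ → ∀ u, Hf (p * u) = Hf u)
    (U : OpenSubgroup (UnitaryGroup.localPi L (IsCMField.complexConj L) (2 + 2) (hermD L e dV hdV dW hdW) v))
    (hf3 : ∀ u k : UnitaryGroup.localPi L (IsCMField.complexConj L) (2 + 2) (hermD L e dV hdV dW hdW) v,
      k ∈ (U : Subgroup (UnitaryGroup.localPi L (IsCMField.complexConj L) (2 + 2) (hermD L e dV hdV dW hdW) v)) → Hf (u * k) = Hf u)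
    (hf4 : ∀ u, ∃ k : ℤ, Hf u ^ 2 = (residueFieldCard (v.adicCompletion (Fp L)) : ℝ) ^ k) (s₀ : ℂ)
    (hG : ∀ s u, G s u = ((Hf u : ℝ) : ℂ) ^ (2 * (s - s₀)) * G s₀ u) :
    ∃ (S : Finset ℝ) (Fc : ℝ → ℂ → UnitaryGroup.localPi L (IsCMField.complexConj L) (2 + 2) (hermD L e dV hdV dW hdW) v → ℂ),
      (∀ (c : ℝ) (s : ℂ) (u : UnitaryGroup.localPi L (IsCMField.complexConj L) (2 + 2) (hermD L e dV hdV dW hdW) v),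
        Fc c s u = if (∃ p k, p ∈ siegelDeltaLoc L e dV hdV dW hdW v ∧ k ∈ K₀ ∧ u = p * k ∧ Hf k = c) then ((c : ℝ) : ℂ) ^ (-(2 * (s - s₀))) * G s u else 0) ∧
      (∀ c ∈ S, 0 < c ∧ ∃ K : ℤ, c ^ 2 = (residueFieldCard (v.adicCompletion (Fp L)) : ℝ) ^ K) ∧
      (haveI : Algebra.IsQuadraticExtension (Fp L) L := IsCMField.isQuadraticExtension L
        ∀ (c : ℝ) (s : ℂ), IsLocalSiegelSection (Fp L) L (IsCMField.complexConj L) (complexConj_imagUnit L) (imagUnit_ne_zero L) (imagUnit_mul_self L)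
          v 2 (gramR_isSymm L e dV hdV dW hdW) (hermD_eq_map_gramD L e dV hdV dW hdW) χv s (Fc c s)) ∧
      (∀ (c : ℝ) (s : ℂ), IsSmooth (Fp L) L (IsCMField.complexConj L) v 2 (Fc c s)) ∧
      (∀ (c : ℝ) (s s' : ℂ), ∀ k ∈ K₀, Fc c s k = Fc c s' k) ∧
      ∀ (s : ℂ) (g : UnitaryGroup.localPi L (IsCMField.complexConj L) (2 + 2) (hermD L e dV hdV dW hdW) v), G s g = ∑ c ∈ S, ((c : ℝ) : ℂ) ^ (2 * (s - s₀)) * Fc c s g := by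
  haveI : Algebra.IsQuadraticExtension (Fp L) L := IsCMField.isQuadraticExtension L
  -- `P_Δ(L⁺_v)` as the subgroup ★ `siegelDeltaLoc v` (★ `mem_siegelDeltaLoc_iff_local`); the Iwasawa letters through it
  have hIw' : ∀ g : UnitaryGroup.localPi L (IsCMField.complexConj L) (2 + 2) (hermD L e dV hdV dW hdW) v, ∃ p ∈ siegelDeltaLoc L e dV hdV dW hdW v, ∃ k ∈ K₀, g = p * k := fun g => by
    obtain ⟨p, hp, k, hk, hg⟩ := hIw g
    exact ⟨p, (mem_siegelDeltaLoc_iff_local L e dV hdV dW hdW v p).2 hp, k, hk, hg⟩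
  have hf2' : ∀ p ∈ siegelDeltaLoc L e dV hdV dW hdW v, p ∈ K₀ → ∀ u, Hf (p * u) = Hf u :=
    fun p hp => hf2 p ((mem_siegelDeltaLoc_iff_local L e dV hdV dW hdW v p).1 hp)
  -- the cut predicate and the pieces (opaque names with defining equations)
  obtain ⟨ψ, hψ⟩ : ∃ ψ : ℝ → UnitaryGroup.localPi L (IsCMField.complexConj L) (2 + 2) (hermD L e dV hdV dW hdW) v → Prop,
      ∀ c u, ψ c u ↔ ∃ p k, p ∈ siegelDeltaLoc L e dV hdV dW hdW v ∧ k ∈ K₀ ∧ u = p * k ∧ Hf k = c := ⟨_, fun _ _ => Iff.rfl⟩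
  obtain ⟨Fc, hFc⟩ : ∃ Fc : ℝ → ℂ → UnitaryGroup.localPi L (IsCMField.complexConj L) (2 + 2) (hermD L e dV hdV dW hdW) v → ℂ,
      ∀ c s u, Fc c s u = if ψ c u then ((c : ℝ) : ℂ) ^ (-(2 * (s - s₀))) * G s u else 0 :=
    ⟨fun c s u => if ψ c u then ((c : ℝ) : ℂ) ^ (-(2 * (s - s₀))) * G s u else 0, fun _ _ _ => rfl⟩
  -- on `K₀` the cut reads `Hf k = c`
  have hψK : ∀ k ∈ K₀, ∀ c, ψ c k ↔ Hf k = c := fun k hk c => by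
    simpa only [one_mul] using cut_iff_of_mul (siegelDeltaLoc L e dV hdV dW hdW v) K₀ Hf ψ hψ hf2' (one_mem _) hk c
  -- the finitely many labels
  have hfin : (Hf '' (K₀ : Set (UnitaryGroup.localPi L (IsCMField.complexConj L) (2 + 2) (hermD L e dV hdV dW hdW) v))).Finite :=
    finite_image_of_mul_right_invariant (K₀ : Set (UnitaryGroup.localPi L (IsCMField.complexConj L) (2 + 2) (hermD L e dV hdV dW hdW) v)) hK₀.1 (U : Subgroup (UnitaryGroup.localPi L (IsCMField.complexConj L) (2 + 2) (hermD L e dV hdV dW hdW) v)) U.isOpen Hf hf3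
  have hSmem : ∀ k ∈ K₀, Hf k ∈ hfin.toFinset := fun k hk => hfin.mem_toFinset.2 (Set.mem_image_of_mem Hf hk)
  refine ⟨hfin.toFinset, Fc, fun c s u => ?_, fun c hc => ?_, fun c s p hp h => ?_, fun c s => ?_, fun c s s' k hk => ?_, fun s g => ?_⟩
  · -- the defining equation, with the cut spelled out
    rw [hFc]
    exact if_congr (hψ c u) rfl rfl
  · -- labels are positive with square in `q_v^ℤ`
    obtain ⟨k, -, rfl⟩ := hfin.mem_toFinset.1 hc
    exact ⟨hf1 k, hf4 k⟩
  · -- Siegel: the cut is left-`P_Δ`-invariant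
    have hiff :=  -- `: ψ c (p * h) ↔ ψ c h`, unascribed (`p h` carry the Literature binder type)
      cut_mul_left_iff (siegelDeltaLoc L e dV hdV dW hdW v) K₀ Hf ψ hψ hf2' hIw' ((mem_siegelDeltaLoc_iff_local L e dV hdV dW hdW v p).2 hp) h c
    by_cases hc : ψ c h
    · rw [hFc, hFc, if_pos (hiff.2 hc), if_pos hc, hSieg s p hp h]
      exact mul_left_comm _ _ _
    · rw [hFc, hFc, if_neg (mt hiff.1 hc), if_neg hc, mul_zero]
  · -- smooth: right-`(U_G ∩ U ∩ K₀)`-invariant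
    have hψU : ∀ x k' : UnitaryGroup.localPi L (IsCMField.complexConj L) (2 + 2) (hermD L e dV hdV dW hdW) v, k' ∈ K₀ →
        k' ∈ (U : Subgroup (UnitaryGroup.localPi L (IsCMField.complexConj L) (2 + 2) (hermD L e dV hdV dW hdW) v)) → (ψ c (x * k') ↔ ψ c x) := fun x k' hk' hk'U =>
      cut_mul_right_iff (siegelDeltaLoc L e dV hdV dW hdW v) K₀ Hf ψ hψ hf2' hIw' hk' (fun y => hf3 y k' hk'U) x c
    obtain ⟨U₁, hU₁⟩ := hsm s
    obtain ⟨K₁, hK₁⟩ : ∃ K₁ : OpenSubgroup (UnitaryGroup.localPi L (IsCMField.complexConj L) (2 + 2) (hermD L e dV hdV dW hdW) v),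
        (K₁ : Subgroup (UnitaryGroup.localPi L (IsCMField.complexConj L) (2 + 2) (hermD L e dV hdV dW hdW) v)) = K₀ := ⟨⟨K₀, hK₀.2⟩, rfl⟩
    refine ⟨U₁ ⊓ (U ⊓ K₁), fun h u hu => ?_⟩
    rw [OpenSubgroup.toSubgroup_inf, OpenSubgroup.toSubgroup_inf, hK₁] at hu
    obtain ⟨hu₁, hu₂, hu₃⟩ := Subgroup.mem_inf.1 hu |>.imp_right Subgroup.mem_inf.1
    have hiff := hψU h u hu₃ hu₂
    by_cases hc : ψ c h
    · rw [hFc, hFc, if_pos (hiff.2 hc), if_pos hc, hU₁ h u hu₁]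
    · rw [hFc, hFc, if_neg (mt hiff.1 hc), if_neg hc]
  · -- `K₀`-flat: on the cut `Hf k = c`, so `F_c s k = G s₀ k`
    by_cases hc : ψ c k
    · have hkc : Hf k = c := (hψK k hk c).1 hc
      have hc0 : ((c : ℝ) : ℂ) ≠ 0 := by exact_mod_cast (hkc ▸ hf1 k).ne'
      have key : ∀ t : ℂ, Fc c t k = G s₀ k := fun t => by
        rw [hFc, if_pos hc, hG t k, hkc, ← mul_assoc, Complex.cpow_neg,
          inv_mul_cancel₀ (fun h0 => hc0 ((Complex.cpow_eq_zero_iff _ _).1 h0).1), one_mul]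
      rw [key s, key s']
    · rw [hFc, hFc, if_neg hc, if_neg hc]
  · -- the pointwise decomposition: exactly one cut per point
    obtain ⟨k, hk, hψk, huniq⟩ := exists_cut (siegelDeltaLoc L e dV hdV dW hdW v) K₀ Hf ψ hψ hf2' hIw' g
    rw [Finset.sum_eq_single_of_mem (Hf k) (hSmem k hk) fun c _ hne => by rw [hFc, if_neg (fun h0 => hne (huniq c h0)), mul_zero]]
    have hc0 : ((Hf k : ℝ) : ℂ) ≠ 0 := by exact_mod_cast (hf1 k).ne'
    rw [hFc, if_pos hψk, ← mul_assoc, Complex.cpow_neg, mul_inv_cancel₀ (fun h0 => hc0 ((Complex.cpow_eq_zero_iff _ _).1 h0).1), one_mul]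

/-! ## §3 The head: ED. 1's two clauses, the pieces exported, the growth reduced to the pieces -/

set_option maxHeartbeats 800000 in -- MEASURED class of ★ p863501 `exists_localFace_kindOneSingular` (its statement in the K2Lit CM telescope, applied once per piece) = ED. 1's class
include hdV0 hdW0 in
/-- **THE K1 TWISTED LOCAL FACE FOR A MONOMIAL-FLAT FAMILY, WITH PIECES AND GROWTH** ((Iw-S₀) FILE B ED. 2).  Binders = ED. 1 VERBATIM.  Conclusion: ED. 1's two clauses
VERBATIM, and `∃ (S : Finset ℝ) (Fc Gn₀)`: (L) labels `c > 0` with `c² ∈ q_v^ℤ`; (P) the pieces BY VALUE; (P1)–(P3) their certificates (smooth Siegel sections, `K₀`-flat —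
so ★ p863501 ∕ ★ p863695 ∕ any value edition applies to each `Fc c`); (G1)(G2) ★ p863501's two clauses for `(Fc c, Gn₀ c)` (with ★ `IsQRationalRegularAt.eq_of_eqOn_halfPlane`
any other witness for `Fc c` agrees with `Gn₀ c` on `0 < re s`); (A) `Gn = Σ_{c ∈ S} c^(2(s−s₀))·Gn₀ c`; (N) `‖Gn s h‖ ≤ Σ_c c^(2re(s−s₀))·‖Gn₀ c s h‖`; (N′) on the unit disc at
any `z`, `‖Gn s h‖ ≤ q_v^M · Σ_c ‖Gn₀ c s h‖` with ONE `M` (uniform in `h` and in `s` on the disc) — the growth of the monomial face is that of its pieces.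
[cite: KudlaRallis1994, §2] [cite: KudlaSweet1997, §1] [cite: HarrisKudlaSweet1996, §6 (6.14)–(6.16)] [cite: Casselman1980, §3 Thm. 3.1] [cite: Shimura1997, §18.1 (18.4)] -/
theorem exists_localFace_kindOneSingular_monomial_growth
    [MeasurableSpace ↥(unipDeltaLoc L e dV hdV dW hdW v)] [BorelSpace ↥(unipDeltaLoc L e dV hdV dW hdW v)] (ν : Measure ↥(unipDeltaLoc L e dV hdV dW hdW v)) [ν.IsHaarMeasure]
    (χv : ∀ w : PlacesOver L v, (w.1.adicCompletion L)ˣ →* ℂˣ) (hχ : ∀ (w' : PlacesOver L v) (x : (w'.1.adicCompletion L)ˣ), ‖((χv w' x : ℂˣ) : ℂ)‖ = 1)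
    (K₀ : Subgroup (UnitaryGroup.localPi L (IsCMField.complexConj L) (2 + 2) (hermD L e dV hdV dW hdW) v))
    (hK₀ : IsCompact (K₀ : Set (UnitaryGroup.localPi L (IsCMField.complexConj L) (2 + 2) (hermD L e dV hdV dW hdW) v)) ∧
      IsOpen (K₀ : Set (UnitaryGroup.localPi L (IsCMField.complexConj L) (2 + 2) (hermD L e dV hdV dW hdW) v)))
    (hIw : haveI : Algebra.IsQuadraticExtension (Fp L) L := IsCMField.isQuadraticExtension L
      ∀ g : UnitaryGroup.localPi L (IsCMField.complexConj L) (2 + 2) (hermD L e dV hdV dW hdW) v,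
        ∃ p, IsSiegelDelta (Fp L) L (IsCMField.complexConj L) (complexConj_imagUnit L) (imagUnit_ne_zero L) (imagUnit_mul_self L)
          v 2 (gramR_isSymm L e dV hdV dW hdW) (hermD_eq_map_gramD L e dV hdV dW hdW) p ∧ ∃ k ∈ K₀, g = p * k)
    (G : ℂ → UnitaryGroup.localPi L (IsCMField.complexConj L) (2 + 2) (hermD L e dV hdV dW hdW) v → ℂ)
    (hSieg : haveI : Algebra.IsQuadraticExtension (Fp L) L := IsCMField.isQuadraticExtension L
      ∀ s, IsLocalSiegelSection (Fp L) L (IsCMField.complexConj L) (complexConj_imagUnit L) (imagUnit_ne_zero L) (imagUnit_mul_self L)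
        v 2 (gramR_isSymm L e dV hdV dW hdW) (hermD_eq_map_gramD L e dV hdV dW hdW) χv s (G s))
    (hsm : ∀ s, IsSmooth (Fp L) L (IsCMField.complexConj L) v 2 (G s))
    -- ★ p863501's `hflat` REPLACED by the MONOMIAL-FLAT letters (f1) (f2ᴷ) (f3) (f4) + `hG` of the (Iw-S₀) road (K1a desk WORD #3 ∕ #6 ∕ #8)
    (Hf : UnitaryGroup.localPi L (IsCMField.complexConj L) (2 + 2) (hermD L e dV hdV dW hdW) v → ℝ) (hf1 : ∀ u, 0 < Hf u)
    (hf2 : haveI : Algebra.IsQuadraticExtension (Fp L) L := IsCMField.isQuadraticExtension L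
      ∀ p : UnitaryGroup.localPi L (IsCMField.complexConj L) (2 + 2) (hermD L e dV hdV dW hdW) v,
        IsSiegelDelta (Fp L) L (IsCMField.complexConj L) (complexConj_imagUnit L) (imagUnit_ne_zero L) (imagUnit_mul_self L)
          v 2 (gramR_isSymm L e dV hdV dW hdW) (hermD_eq_map_gramD L e dV hdV dW hdW) p → p ∈ K₀ → ∀ u, Hf (p * u) = Hf u)
    (U : OpenSubgroup (UnitaryGroup.localPi L (IsCMField.complexConj L) (2 + 2) (hermD L e dV hdV dW hdW) v))
    (hf3 : ∀ u k : UnitaryGroup.localPi L (IsCMField.complexConj L) (2 + 2) (hermD L e dV hdV dW hdW) v,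
      k ∈ (U : Subgroup (UnitaryGroup.localPi L (IsCMField.complexConj L) (2 + 2) (hermD L e dV hdV dW hdW) v)) → Hf (u * k) = Hf u)
    (hf4 : ∀ u, ∃ k : ℤ, Hf u ^ 2 = (residueFieldCard (v.adicCompletion (Fp L)) : ℝ) ^ k) (s₀ : ℂ)
    (hG : ∀ s u, G s u = ((Hf u : ℝ) : ℂ) ^ (2 * (s - s₀)) * G s₀ u)
    (σ : L) (hτ : gramR L e dV hdV dW hdW 1 1 * Algebra.trace (Fp L) L (σ * imagUnit L) ≠ 0) :
    ∃ Gn : ℂ → UnitaryGroup.localPi L (IsCMField.complexConj L) (2 + 2) (hermD L e dV hdV dW hdW) v → ℂ,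
      (∀ s₀ : ℂ, 0 < s₀.re → ∀ h, IsQRationalRegularAt (residueFieldCard (v.adicCompletion (Fp L))) s₀ (fun s => Gn s h)) ∧
      (∀ s : ℂ, 1 < s.re → ∀ h : UnitaryGroup.localPi L (IsCMField.complexConj L) (2 + 2) (hermD L e dV hdV dW hdW) v,
        ∫ y : ↥(unipDeltaLoc L e dV hdV dW hdW v), conj ((unipDeltaChar L e dV hdV dW hdW (Matrix.single 1 1 σ)
              (locToAdelic L e dV hdV dW hdW v (y : UnitaryGroup.localPi L (IsCMField.complexConj L) (2 + 2) (hermD L e dV hdV dW hdW) v)) : ℂ)) *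
            G s (UnitaryGroup.evalPlace (Fp L) L (IsCMField.complexConj L) (2 + 2) (hermD L e dV hdV dW hdW) v
                  (UnitaryGroup.finPart (Fp L) L (IsCMField.complexConj L) (2 + 2) (hermD L e dV hdV dW hdW) (SiegelDoubled.weylDelta L e dV hdV dW hdW)) *
              (y : UnitaryGroup.localPi L (IsCMField.complexConj L) (2 + 2) (hermD L e dV hdV dW hdW) v) * h) ∂ν = Gn s h) ∧
      ∃ (S : Finset ℝ) (Fc Gn₀ : ℝ → ℂ → UnitaryGroup.localPi L (IsCMField.complexConj L) (2 + 2) (hermD L e dV hdV dW hdW) v → ℂ),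
        (∀ c ∈ S, 0 < c ∧ ∃ K : ℤ, c ^ 2 = (residueFieldCard (v.adicCompletion (Fp L)) : ℝ) ^ K) ∧
        (∀ (c : ℝ) (s : ℂ) (u : UnitaryGroup.localPi L (IsCMField.complexConj L) (2 + 2) (hermD L e dV hdV dW hdW) v),
          Fc c s u = if (∃ p k, p ∈ siegelDeltaLoc L e dV hdV dW hdW v ∧ k ∈ K₀ ∧ u = p * k ∧ Hf k = c) then ((c : ℝ) : ℂ) ^ (-(2 * (s - s₀))) * G s u else 0) ∧
        (haveI : Algebra.IsQuadraticExtension (Fp L) L := IsCMField.isQuadraticExtension L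
          ∀ (c : ℝ) (s : ℂ), IsLocalSiegelSection (Fp L) L (IsCMField.complexConj L) (complexConj_imagUnit L) (imagUnit_ne_zero L) (imagUnit_mul_self L)
            v 2 (gramR_isSymm L e dV hdV dW hdW) (hermD_eq_map_gramD L e dV hdV dW hdW) χv s (Fc c s)) ∧
        (∀ (c : ℝ) (s : ℂ), IsSmooth (Fp L) L (IsCMField.complexConj L) v 2 (Fc c s)) ∧
        (∀ (c : ℝ) (s s' : ℂ), ∀ k ∈ K₀, Fc c s k = Fc c s' k) ∧
        (∀ (c : ℝ) (s₀ : ℂ), 0 < s₀.re → ∀ h, IsQRationalRegularAt (residueFieldCard (v.adicCompletion (Fp L))) s₀ (fun s => Gn₀ c s h)) ∧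
        (∀ (c : ℝ) (s : ℂ), 1 < s.re → ∀ h : UnitaryGroup.localPi L (IsCMField.complexConj L) (2 + 2) (hermD L e dV hdV dW hdW) v,
          ∫ y : ↥(unipDeltaLoc L e dV hdV dW hdW v), conj ((unipDeltaChar L e dV hdV dW hdW (Matrix.single 1 1 σ)
              (locToAdelic L e dV hdV dW hdW v (y : UnitaryGroup.localPi L (IsCMField.complexConj L) (2 + 2) (hermD L e dV hdV dW hdW) v)) : ℂ)) *
              Fc c s (UnitaryGroup.evalPlace (Fp L) L (IsCMField.complexConj L) (2 + 2) (hermD L e dV hdV dW hdW) v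
                  (UnitaryGroup.finPart (Fp L) L (IsCMField.complexConj L) (2 + 2) (hermD L e dV hdV dW hdW) (SiegelDoubled.weylDelta L e dV hdV dW hdW)) *
                (y : UnitaryGroup.localPi L (IsCMField.complexConj L) (2 + 2) (hermD L e dV hdV dW hdW) v) * h) ∂ν = Gn₀ c s h) ∧
        (∀ (s : ℂ) (h : UnitaryGroup.localPi L (IsCMField.complexConj L) (2 + 2) (hermD L e dV hdV dW hdW) v), Gn s h = ∑ c ∈ S, ((c : ℝ) : ℂ) ^ (2 * (s - s₀)) * Gn₀ c s h) ∧
        (∀ (s : ℂ) (h : UnitaryGroup.localPi L (IsCMField.complexConj L) (2 + 2) (hermD L e dV hdV dW hdW) v), ‖Gn s h‖ ≤ ∑ c ∈ S, c ^ (2 * (s - s₀).re) * ‖Gn₀ c s h‖) ∧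
        ∀ z : ℂ, ∃ M : ℕ, ∀ s : ℂ, dist s z < 1 → ∀ h : UnitaryGroup.localPi L (IsCMField.complexConj L) (2 + 2) (hermD L e dV hdV dW hdW) v,
          ‖Gn s h‖ ≤ ((residueFieldCard (v.adicCompletion (Fp L)) : ℝ) ^ M) * ∑ c ∈ S, ‖Gn₀ c s h‖ := by
  obtain ⟨S, Fc, hFc, hSpos, hSiegc, hsmc, hflatc, hdec⟩ :=
    exists_monomialFlat_pieces_eq L e dV hdV dW hdW v χv K₀ hK₀ hIw G hSieg hsm Hf hf1 hf2 U hf3 hf4 s₀ hG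
  -- ★ p863501 per piece
  choose Gn₀ hreg₀ hval₀ using fun c : ℝ =>
    exists_localFace_kindOneSingular L e dV hdV hdV0 dW hdW hdW0 v ν χv hχ K₀ hK₀ hIw (Fc c) (hSiegc c) (hsmc c) (hflatc c) σ hτ
  -- the growth reduction (N), once
  have hN : ∀ (s : ℂ) (h : UnitaryGroup.localPi L (IsCMField.complexConj L) (2 + 2) (hermD L e dV hdV dW hdW) v),
      ‖∑ c ∈ S, ((c : ℝ) : ℂ) ^ (2 * (s - s₀)) * Gn₀ c s h‖ ≤ ∑ c ∈ S, c ^ (2 * (s - s₀).re) * ‖Gn₀ c s h‖ := fun s h =>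
    (norm_sum_mul_le S _ _).trans (le_of_eq (Finset.sum_congr rfl fun c hc => by rw [norm_cpow_two_mul (hSpos c hc).1]))
  have hq1 : (1 : ℝ) ≤ (residueFieldCard (v.adicCompletion (Fp L)) : ℝ) := by
    exact_mod_cast Nat.one_le_iff_ne_zero.2 (residueFieldCard_ne_zero _)
  refine ⟨fun s h => ∑ c ∈ S, ((c : ℝ) : ℂ) ^ (2 * (s - s₀)) * Gn₀ c s h, fun s₁ hs₁ h => ?_, fun s hs h => ?_,
    S, Fc, Gn₀, hSpos, hFc, hSiegc, hsmc, hflatc, hreg₀, hval₀, fun s h => rfl, hN, fun z => ?_⟩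
  · -- regularity: a finite sum of (monomial in `q_v^(−s)`) × (★ p863501's regular letter)
    refine IsQRationalRegularAt.sum S fun c hc => IsQRationalRegularAt.mul ?_ (hreg₀ c s₁ hs₁ h)
    obtain ⟨hc0, K, hK⟩ := hSpos c hc
    refine (isQRationalRegularAt_zpow_cpow_add (residueFieldCard_ne_zero _) K (-s₀) s₁).congr fun s => ?_
    rw [← hK, ← sub_eq_add_neg, cpow_two_mul_of_pos hc0]
  · -- the twisted big-cell integral on `1 < re s`: a finite sum of ★ V1c-integrable pieces
    exact integral_mul_eq_sum ν S (fun c => ((c : ℝ) : ℂ) ^ (2 * (s - s₀))) (fun c => Gn₀ c s h)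
      (fun y => conj ((unipDeltaChar L e dV hdV dW hdW (Matrix.single 1 1 σ)
              (locToAdelic L e dV hdV dW hdW v (y : UnitaryGroup.localPi L (IsCMField.complexConj L) (2 + 2) (hermD L e dV hdV dW hdW) v)) : ℂ)))
      (fun y => G s (UnitaryGroup.evalPlace (Fp L) L (IsCMField.complexConj L) (2 + 2) (hermD L e dV hdV dW hdW) v
                  (UnitaryGroup.finPart (Fp L) L (IsCMField.complexConj L) (2 + 2) (hermD L e dV hdV dW hdW) (SiegelDoubled.weylDelta L e dV hdV dW hdW)) *
              (y : UnitaryGroup.localPi L (IsCMField.complexConj L) (2 + 2) (hermD L e dV hdV dW hdW) v) * h))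
      (fun c y => Fc c s (UnitaryGroup.evalPlace (Fp L) L (IsCMField.complexConj L) (2 + 2) (hermD L e dV hdV dW hdW) v
                  (UnitaryGroup.finPart (Fp L) L (IsCMField.complexConj L) (2 + 2) (hermD L e dV hdV dW hdW) (SiegelDoubled.weylDelta L e dV hdV dW hdW)) *
              (y : UnitaryGroup.localPi L (IsCMField.complexConj L) (2 + 2) (hermD L e dV hdV dW hdW) v) * h))
      (fun y => hdec s _) (fun c => integrable_conj_unipDeltaChar_mul L e dV hdV hdV0 dW hdW hdW0 v ν χv hχ hs (hSiegc c s) (hsmc c s) _ h)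
      fun c => hval₀ c s hs h
  · -- the growth clause on the unit disc at `z`
    obtain ⟨M, hM⟩ := exists_uniform_pow_bound hq1 S hSpos z s₀
    refine ⟨M, fun s hs h => (hN s h).trans ?_⟩
    rw [Finset.mul_sum]
    exact Finset.sum_le_sum fun c hc => mul_le_mul_of_nonneg_right (hM s hs c hc) (norm_nonneg _)

end CM

end Summit.HodgeConjecture.HodgeConjecture.Cruxes.HLiu418.K2LiuKindOneSingularLocalFaceMonomialGrowth

end
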